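import Mathlib
import Summits.NavierStokesRegularity.NavierStokesRegularity.Theorems.FilamentSkeletonRssTangentSkeletonLDatumReduction
import Summits.NavierStokesRegularity.NavierStokesRegularity.Theorems.FilamentSkeletonRssAnalyticStripStadiumDefs

/-!
# `TangentSkeletonNearStraightL` (stmt-NavierStokesRegularity-23320) and the closing stub's output `TangentSkeletonAnalyticL` —
# THE CURVE CORE: under Variant A1L the whole core-area dimension is discharged by RIGID UNIT CORES `Aa ≡ 1`, `KA = 1`

Variant A1L (rigid matched cores) replaced the area transport law by `1 ≤ KA·Aa(c_j)` + `Aa ≡ Aa(c_j)` on the doubled ball + the Γ-flat cone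
bound `Rw²Γ·Aa ≤ KA(Rw²Γ + ‖X‖²)`; the near-straight regime adds the floor `Λ⁻¹ ≤ Aa`, and the closing stub `stub_analyticClosingL` of the registered
line `child_tangent_analytic_strip_L` (b0b56c52900dd90a) adds `StadiumAnalyticArea`.  EVERY ONE of these is satisfied by the constant `Aa ≡ 1` with
`KA = 1` (and `Λ ≥ 1`): the (X, Aa) ↦ v ↦ w ↦ Aa feedback of the informal text is not merely «absent on the flat range» — it is absent.  So the heart
⟨23320⟩, and the output `TangentSkeletonAnalyticL` of its hard stub, are statements about CURVES ONLY, for the FIXED unit-core Rosenhead–Moore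
kernel `((‖y − Z‖² + e^{−(1+γ_E−log 2)})^{3/2})⁻¹`.  This file records the two reductions as importable theorems with the curve-only core written out
(def-free; the core keeps the `∀ u v, defining equations → clauses` shape of `FlatJ1L` with the binders `A`, `T` and the two `Aa` clauses dropped):
* `tangentSkeletonNearStraightL_of_curveCore` — the ROUTE DECL ⟨23320⟩ BY NAME from the datum-free curve core (through
  `Theorems.TangentSkeletonLDatumReduction.tangentSkeletonNearStraightL_of_core`, p-landed: the datum enters only through `N ≥ 2`, `(γ, α)` and the box);
* `tangentSkeletonAnalyticL_of_analyticCurveCore` — the closing stub's output `TangentSkeletonAnalyticL` (the line's §3 text VERBATIM over the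
  Theorems-side copies `…SkeletonJ1GSplit.StraightDatum/NearStraightJ1G`, `…SkeletonJ1LSplit.FlatJ1L`, `…AnalyticStripStadium.StadiumAnalyticCurve/Area`)
  from the curve core + ONE analyticity conjunct `StadiumAnalyticCurve (cs√Γ) (Rb√(Γ log Γ)) (c j) (X j)`; the area conjunct is the constant witness
  `G ≡ 1` (cf. `Theorems.StadiumRigidArea.stadiumAnalyticArea_of_const`).
Consequence for the planner (exact remaining content of line (C) after P2, P3): `AnalyticNewtonClosingL` ⟸ «for every `N ≥ 2`, `θd > 0`, `(γ, α)` in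
the `θd`-box: box constants, `cs > 0`, `Rb₁ > 0`, and for all `0 < Rb ≤ Rb₁`, all large `Γ`, unit-speed `C²` curves `X_j` with slips `w_j` and zeros
`c_j` satisfying the twelve curve clauses below for the unit-core field, tangent oscillation `≤ Rb`, `|w_j′| ≤ Λ`, each `X_j` stadium-analytic of
half-width `cs√Γ` around its ball segment» — no core-area unknown, no area analyticity.
HONEST FRAMING: bookkeeping (pure logic + `Aa := 1`) about a HYPOTHETICAL filament skeleton on the NEGATIVE side of a MODEL route; no registered stub
of 23320 is closed, `TangentSkeletonNearStraightL` / `SkeletonJ1L` stay OPEN; nothing here bears on Navier–Stokes regularity or blow-up.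
`--supports stmt-NavierStokesRegularity-23320`. [folklore]
-/

set_option linter.dupNamespace false

noncomputable section

namespace Summit.NavierStokesRegularity.NavierStokesRegularity.Theorems.TangentSkeletonLCurveCore

open Filter
open scoped InnerProductSpace BigOperators
open Literature.Analysis.FluidPDE
open Summit.NavierStokesRegularity.NavierStokesRegularity.Theorems.FilamentSkeletonRssSkeletonJ1GSplit (NearStraightJ1G StraightDatum)
open Summit.NavierStokesRegularity.NavierStokesRegularity.Theorems.FilamentSkeletonRssSkeletonJ1LSplit (FlatJ1L)
open Summit.NavierStokesRegularity.NavierStokesRegularity.Theorems.TangentSkeletonLDatumReduction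
open Summit.NavierStokesRegularity.NavierStokesRegularity.Theorems.AnalyticStripStadium (StadiumAnalyticCurve StadiumAnalyticArea)

/-- **Unit cores discharge the flat clause block.**  If the twelve CURVE clauses of `FlatJ1L` hold for the unit-core field (the `∀ u v, defining
equations → clauses` shape with `Aa ≡ 1` substituted), then `FlatJ1L … KA Γ γ α X w c Aa` holds with `KA := 1`, `Aa := fun _ _ => 1`. [folklore] -/
theorem flatJ1L_of_unitCore {N : ℕ} {δ ρ K Λ Rw Rb cg θ₀ Γ : ℝ} {γ : Fin N → ℝ} {α : ℝ}
    {X : Fin N → ℝ → EuclideanSpace ℝ (Fin 3)} {w : Fin N → ℝ → ℝ} {c : Fin N → ℝ}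
    (hcl : ∀ (u : (Fin N → ℝ → EuclideanSpace ℝ (Fin 3)) → EuclideanSpace ℝ (Fin 3) → EuclideanSpace ℝ (Fin 3))
      (v : EuclideanSpace ℝ (Fin 3) → EuclideanSpace ℝ (Fin 3)),
      (∀ Z y, u Z y = ∑ k, (Γ*γ k/(4*Real.pi))•∫ σ:ℝ, ((‖y-Z k σ‖^2+Real.exp (-(1+Real.eulerMascheroniConstant-Real.log 2)))^(3/2:ℝ))⁻¹•cross (deriv (Z k) σ) (y-Z k σ)) →
      (∀ y, v y = u X y+(1/2:ℝ)•y-α•cross (EuclideanSpace.single 2 1) y) →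
      (α ≠ 0 ∧ (∀ j, γ j ≠ 0) ∧
       (∀ j, ContDiff ℝ 2 (X j) ∧ Differentiable ℝ (w j) ∧ (∀ τ, ‖deriv (X j) τ‖ = 1) ∧ (∀ τ, ‖iteratedDeriv 2 (X j) τ‖*√Γ≤K) ∧
         Tendsto (fun τ => ‖X j τ‖) (cocompact ℝ) atTop) ∧
       (∀ j k, j ≠ k → ∀ τ σ, ρ*√Γ≤‖X j τ-X k σ‖) ∧ (∀ j τ σ, ρ*√Γ≤|τ-σ| → cg*ρ*√Γ≤‖X j τ-X j σ‖) ∧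
       (∀ j τ, cg*|τ-c j|≤Rw*√Γ+‖X j τ‖) ∧ (∀ j τ, w j τ = ⟪v (X j τ), deriv (X j) τ⟫_ℝ) ∧
       (∀ j τ, ‖X j τ‖≤Rb*√(Γ*Real.log Γ) → v (X j τ) = w j τ•deriv (X j) τ) ∧ (∀ j, ‖X j (c j)‖≤Rw*√Γ) ∧
       (∀ j, |⟪deriv (X j) (c j), EuclideanSpace.single 2 1⟫_ℝ|≤1-θ₀) ∧ (θ₀≤|α| ∧ |α|≤θ₀⁻¹ ∧ ∀ j, θ₀≤|γ j| ∧ |γ j|≤θ₀⁻¹) ∧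
       (∀ j, w j (c j) = 0 ∧ (∀ τ, w j τ = 0 → τ = c j) ∧ 3/2+δ≤deriv (w j) (c j) ∧ deriv (w j) (c j)≤Λ))) :
    FlatJ1L N δ ρ K Λ Rw Rb cg θ₀ 1 Γ γ α X w c (fun _ _ => 1) := by
  dsimp only [FlatJ1L]
  intro u v A T hu hv _hA _hT
  have hu' : ∀ Z y, u Z y = ∑ k, (Γ*γ k/(4*Real.pi))•∫ σ:ℝ,
      ((‖y-Z k σ‖^2+Real.exp (-(1+Real.eulerMascheroniConstant-Real.log 2)))^(3/2:ℝ))⁻¹•cross (deriv (Z k) σ) (y-Z k σ) := by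
    intro Z y
    rw [hu Z y]
    simp only [mul_one]
  obtain ⟨h0, h1, h2, h3, h4, h5, h6, h7, h8, h9, h10, h11⟩ := hcl u v hu' hv
  refine ⟨h0, h1, h2, h3, h4, h5, h6, h7, h8, h9, h10, h11, ?_, ?_⟩
  · intro j
    exact ⟨differentiable_const _, fun _ => one_pos, by norm_num, fun _ _ => rfl⟩
  · intro j τ
    nlinarith [sq_nonneg ‖X j τ‖]

/-- **Unit cores discharge the near-straight regime's floor**: with `Λ ≥ 1`, `NearStraightJ1G N Λ Rb X w (fun _ _ => 1)` is the two curve clauses. [folklore] -/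
theorem nearStraightJ1G_of_unitCore {N : ℕ} {Λ Rb : ℝ} {X : Fin N → ℝ → EuclideanSpace ℝ (Fin 3)} {w : Fin N → ℝ → ℝ}
    (hΛ : 1 ≤ Λ) (hosc : ∀ j τ σ, ‖deriv (X j) τ - deriv (X j) σ‖ ≤ Rb) (hw' : ∀ j τ, |deriv (w j) τ| ≤ Λ) :
    NearStraightJ1G N Λ Rb X w (fun _ _ => 1) := by
  dsimp only [NearStraightJ1G]
  exact ⟨hosc, hw', fun _ _ => inv_le_one_of_one_le₀ hΛ⟩

/-- **Unit cores discharge the area-analyticity conjunct**: `StadiumAnalyticArea hs L cc (fun _ => 1)` by the constant witness `G ≡ 1`. [folklore] -/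
theorem stadiumAnalyticArea_one (hs L cc : ℝ) : StadiumAnalyticArea hs L cc (fun _ => (1:ℝ)) := by
  refine ⟨fun _ => (1:ℂ), differentiableOn_const _, fun _ _ => by simp, fun _ _ => ⟨by norm_num, by norm_num⟩⟩

/-- ★ **THE ROUTE DECL ⟨23320⟩ BY NAME FROM THE CURVE CORE.**  HYPOTHESIS (the curve core): for every `N ≥ 2`, `θd > 0`, `(γ, α)` in the `θd`-box,
box constants with `2Kρ ≤ 1`, `Λ ≥ 1`, a ceiling `Rb₁ > 0`, and for all `0 < Rb ≤ Rb₁`, all `Γ ≥ Γ₂(Rb)`, curves `X`, slips `w`, zeros `c` satisfying the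
twelve curve clauses of `FlatJ1L` for the UNIT-CORE field, tangent oscillation `≤ Rb` and `|w′| ≤ Λ`.  CONCLUSION:
`Theses.FilamentSkeletonRss.TangentSkeletonNearStraightL`. [folklore] -/
theorem tangentSkeletonNearStraightL_of_curveCore
    (hcore : ∀ (N : ℕ) (θd : ℝ) (γ : Fin N → ℝ) (α : ℝ), 2 ≤ N → 0 < θd →
      (θd ≤ |α| ∧ |α| ≤ θd⁻¹ ∧ ∀ j, θd ≤ |γ j| ∧ |γ j| ≤ θd⁻¹) →
      ∃ (δ ρ K Λ Rw cg θ₀ Rb₁ : ℝ), 0 < δ ∧ 0 < ρ ∧ 0 < Rw ∧ 0 < cg ∧ 0 < θ₀ ∧ 0 < Rb₁ ∧ 2 * K * ρ ≤ 1 ∧ 1 ≤ Λ ∧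
        ∀ Rb : ℝ, 0 < Rb → Rb ≤ Rb₁ → ∃ Γ₂ : ℝ, ∀ Γ : ℝ, Γ₂ ≤ Γ →
          ∃ (X : Fin N → ℝ → EuclideanSpace ℝ (Fin 3)) (w : Fin N → ℝ → ℝ) (c : Fin N → ℝ),
            (∀ (u : (Fin N → ℝ → EuclideanSpace ℝ (Fin 3)) → EuclideanSpace ℝ (Fin 3) → EuclideanSpace ℝ (Fin 3))
              (v : EuclideanSpace ℝ (Fin 3) → EuclideanSpace ℝ (Fin 3)),
              (∀ Z y, u Z y = ∑ k, (Γ*γ k/(4*Real.pi))•∫ σ:ℝ, ((‖y-Z k σ‖^2+Real.exp (-(1+Real.eulerMascheroniConstant-Real.log 2)))^(3/2:ℝ))⁻¹•cross (deriv (Z k) σ) (y-Z k σ)) →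
              (∀ y, v y = u X y+(1/2:ℝ)•y-α•cross (EuclideanSpace.single 2 1) y) →
              (α ≠ 0 ∧ (∀ j, γ j ≠ 0) ∧
               (∀ j, ContDiff ℝ 2 (X j) ∧ Differentiable ℝ (w j) ∧ (∀ τ, ‖deriv (X j) τ‖ = 1) ∧ (∀ τ, ‖iteratedDeriv 2 (X j) τ‖*√Γ≤K) ∧
                 Tendsto (fun τ => ‖X j τ‖) (cocompact ℝ) atTop) ∧
               (∀ j k, j ≠ k → ∀ τ σ, ρ*√Γ≤‖X j τ-X k σ‖) ∧ (∀ j τ σ, ρ*√Γ≤|τ-σ| → cg*ρ*√Γ≤‖X j τ-X j σ‖) ∧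
               (∀ j τ, cg*|τ-c j|≤Rw*√Γ+‖X j τ‖) ∧ (∀ j τ, w j τ = ⟪v (X j τ), deriv (X j) τ⟫_ℝ) ∧
               (∀ j τ, ‖X j τ‖≤Rb*√(Γ*Real.log Γ) → v (X j τ) = w j τ•deriv (X j) τ) ∧ (∀ j, ‖X j (c j)‖≤Rw*√Γ) ∧
               (∀ j, |⟪deriv (X j) (c j), EuclideanSpace.single 2 1⟫_ℝ|≤1-θ₀) ∧ (θ₀≤|α| ∧ |α|≤θ₀⁻¹ ∧ ∀ j, θ₀≤|γ j| ∧ |γ j|≤θ₀⁻¹) ∧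
               (∀ j, w j (c j) = 0 ∧ (∀ τ, w j τ = 0 → τ = c j) ∧ 3/2+δ≤deriv (w j) (c j) ∧ deriv (w j) (c j)≤Λ))) ∧
            (∀ j τ σ, ‖deriv (X j) τ - deriv (X j) σ‖ ≤ Rb) ∧ (∀ j τ, |deriv (w j) τ| ≤ Λ)) :
    Summit.NavierStokesRegularity.NavierStokesRegularity.Theses.FilamentSkeletonRss.TangentSkeletonNearStraightL := by
  refine tangentSkeletonNearStraightL_of_core ?_
  intro N θd γ α hN hθ hbox
  obtain ⟨δ, ρ, K, Λ, Rw, cg, θ₀, Rb₁, hδ, hρ, hRw, hcg, hθ₀, hRb₁, hKρ, hΛ1, hfam⟩ := hcore N θd γ α hN hθ hbox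
  refine ⟨δ, ρ, K, Λ, Rw, cg, θ₀, 1, Rb₁, hδ, hρ, hRw, hcg, hθ₀, hRb₁, hKρ, ?_⟩
  intro Rb hRb hRb1
  obtain ⟨Γ₂, hΓ⟩ := hfam Rb hRb hRb1
  refine ⟨Γ₂, fun Γ hΓ2 => ?_⟩
  obtain ⟨X, w, c, hcl, hosc, hw'⟩ := hΓ Γ hΓ2
  exact ⟨X, w, c, fun _ _ => 1, flatJ1L_of_unitCore hcl, nearStraightJ1G_of_unitCore hΛ1 hosc hw'⟩

/-- ★ **THE CLOSING STUB'S OUTPUT FROM THE ANALYTIC CURVE CORE.**  HYPOTHESIS: the curve core of `tangentSkeletonNearStraightL_of_curveCore` plus a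
half-width constant `cs > 0` and ONE analyticity conjunct `StadiumAnalyticCurve (cs√Γ) (Rb√(Γ log Γ)) (c j) (X j)` per filament.  CONCLUSION: the text of
`TangentSkeletonAnalyticL` (line `child_tangent_analytic_strip_L` §3, verbatim over the Theorems-side copies of its pieces) — the strengthened child
that `stub_analyticClosingL : StripPropagation → LiaSymbolBound → TangentSkeletonAnalyticL` must produce; the area conjunct is the constant witness. [folklore] -/
theorem tangentSkeletonAnalyticL_of_analyticCurveCore
    (hcore : ∀ (N : ℕ) (θd : ℝ) (γ : Fin N → ℝ) (α : ℝ), 2 ≤ N → 0 < θd →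
      (θd ≤ |α| ∧ |α| ≤ θd⁻¹ ∧ ∀ j, θd ≤ |γ j| ∧ |γ j| ≤ θd⁻¹) →
      ∃ (δ ρ K Λ Rw cg θ₀ Rb₁ cs : ℝ), 0 < δ ∧ 0 < ρ ∧ 0 < Rw ∧ 0 < cg ∧ 0 < θ₀ ∧ 0 < Rb₁ ∧ 0 < cs ∧ 2 * K * ρ ≤ 1 ∧ 1 ≤ Λ ∧
        ∀ Rb : ℝ, 0 < Rb → Rb ≤ Rb₁ → ∃ Γ₂ : ℝ, ∀ Γ : ℝ, Γ₂ ≤ Γ →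
          ∃ (X : Fin N → ℝ → EuclideanSpace ℝ (Fin 3)) (w : Fin N → ℝ → ℝ) (c : Fin N → ℝ),
            (∀ (u : (Fin N → ℝ → EuclideanSpace ℝ (Fin 3)) → EuclideanSpace ℝ (Fin 3) → EuclideanSpace ℝ (Fin 3))
              (v : EuclideanSpace ℝ (Fin 3) → EuclideanSpace ℝ (Fin 3)),
              (∀ Z y, u Z y = ∑ k, (Γ*γ k/(4*Real.pi))•∫ σ:ℝ, ((‖y-Z k σ‖^2+Real.exp (-(1+Real.eulerMascheroniConstant-Real.log 2)))^(3/2:ℝ))⁻¹•cross (deriv (Z k) σ) (y-Z k σ)) →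
              (∀ y, v y = u X y+(1/2:ℝ)•y-α•cross (EuclideanSpace.single 2 1) y) →
              (α ≠ 0 ∧ (∀ j, γ j ≠ 0) ∧
               (∀ j, ContDiff ℝ 2 (X j) ∧ Differentiable ℝ (w j) ∧ (∀ τ, ‖deriv (X j) τ‖ = 1) ∧ (∀ τ, ‖iteratedDeriv 2 (X j) τ‖*√Γ≤K) ∧
                 Tendsto (fun τ => ‖X j τ‖) (cocompact ℝ) atTop) ∧
               (∀ j k, j ≠ k → ∀ τ σ, ρ*√Γ≤‖X j τ-X k σ‖) ∧ (∀ j τ σ, ρ*√Γ≤|τ-σ| → cg*ρ*√Γ≤‖X j τ-X j σ‖) ∧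
               (∀ j τ, cg*|τ-c j|≤Rw*√Γ+‖X j τ‖) ∧ (∀ j τ, w j τ = ⟪v (X j τ), deriv (X j) τ⟫_ℝ) ∧
               (∀ j τ, ‖X j τ‖≤Rb*√(Γ*Real.log Γ) → v (X j τ) = w j τ•deriv (X j) τ) ∧ (∀ j, ‖X j (c j)‖≤Rw*√Γ) ∧
               (∀ j, |⟪deriv (X j) (c j), EuclideanSpace.single 2 1⟫_ℝ|≤1-θ₀) ∧ (θ₀≤|α| ∧ |α|≤θ₀⁻¹ ∧ ∀ j, θ₀≤|γ j| ∧ |γ j|≤θ₀⁻¹) ∧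
               (∀ j, w j (c j) = 0 ∧ (∀ τ, w j τ = 0 → τ = c j) ∧ 3/2+δ≤deriv (w j) (c j) ∧ deriv (w j) (c j)≤Λ))) ∧
            (∀ j τ σ, ‖deriv (X j) τ - deriv (X j) σ‖ ≤ Rb) ∧ (∀ j τ, |deriv (w j) τ| ≤ Λ) ∧
            (∀ j, StadiumAnalyticCurve (cs * √Γ) (Rb * √(Γ * Real.log Γ)) (c j) (X j))) :
    ∀ (N : ℕ) (δ ρ Λ Rw θ₀ mw : ℝ) (p t : Fin N → EuclideanSpace ℝ (Fin 3)) (γ : Fin N → ℝ) (α : ℝ) (s₀ : Fin N → ℝ),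
      0 < N → 0 < δ → 0 < ρ → 0 < Rw → 0 < θ₀ → 0 < mw → StraightDatum N δ ρ Λ Rw θ₀ mw p t γ α s₀ →
      (∀ j k, j ≠ k → |⟪t j, t k⟫_ℝ| ≤ 1 - θ₀) →
      ∃ (δ' ρ' K Λ' Rw' cg θ₀' KA Rb₁ cs : ℝ), 0 < δ' ∧ 0 < ρ' ∧ 0 < Rw' ∧ 0 < cg ∧ 0 < θ₀' ∧ 0 < Rb₁ ∧ 0 < cs ∧
        2 * K * ρ' ≤ 1 ∧ ∀ Rb : ℝ, 0 < Rb → Rb ≤ Rb₁ → ∃ Γ₂ : ℝ, ∀ Γ : ℝ, Γ₂ ≤ Γ →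
          ∃ (X : Fin N → ℝ → EuclideanSpace ℝ (Fin 3)) (w : Fin N → ℝ → ℝ) (c : Fin N → ℝ) (Aa : Fin N → ℝ → ℝ),
            FlatJ1L N δ' ρ' K Λ' Rw' Rb cg θ₀' KA Γ γ α X w c Aa ∧ NearStraightJ1G N Λ' Rb X w Aa ∧
            (∀ j, StadiumAnalyticCurve (cs * √Γ) (Rb * √(Γ * Real.log Γ)) (c j) (X j)) ∧
            (∀ j, StadiumAnalyticArea (cs * √Γ) (Rb * √(Γ * Real.log Γ)) (c j) (Aa j)) := by
  intro N δd ρd Λd Rwd θd mw p t γ α s₀ hN hδ _hρ _hRw hθ _hmw hSD _hGP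
  obtain ⟨δ, ρ, K, Λ, Rw, cg, θ₀, Rb₁, cs, hδ', hρ', hRw', hcg, hθ₀', hRb₁, hcs, hKρ, hΛ1, hfam⟩ :=
    hcore N θd γ α (straightDatum_two_le hδ hN hSD) hθ (straightDatum_paramBox hSD)
  refine ⟨δ, ρ, K, Λ, Rw, cg, θ₀, 1, Rb₁, cs, hδ', hρ', hRw', hcg, hθ₀', hRb₁, hcs, hKρ, ?_⟩
  intro Rb hRb hRb1
  obtain ⟨Γ₂, hΓ⟩ := hfam Rb hRb hRb1
  refine ⟨Γ₂, fun Γ hΓ2 => ?_⟩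
  obtain ⟨X, w, c, hcl, hosc, hw', han⟩ := hΓ Γ hΓ2
  exact ⟨X, w, c, fun _ _ => 1, flatJ1L_of_unitCore hcl, nearStraightJ1G_of_unitCore hΛ1 hosc hw', han,
    fun j => stadiumAnalyticArea_one _ _ _⟩

end Summit.NavierStokesRegularity.NavierStokesRegularity.Theorems.TangentSkeletonLCurveCore

end
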